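import Literature.Topology.FourManifolds.WeaklyReducibleTrisections
import Literature.Topology.FourManifolds.ImmersionCriterion
import Literature.Topology.FourManifolds.EquidimensionalEmbedding
import Literature.Analysis.Calculus.LocalInverseOnCompact
import Literature.Geometry.Manifold.SmoothEmbeddingInverse
import HarnessLib

/-!
# Images of open plane sets under an annular chart of the central surface are open in it

Helper file (`--supports stmt-SmoothPoincare4-18000`, registered helper
`helper_hasDependentTriple_of_isWeaklyReducible` of the skeleton
`Cruxes/DependentTripleGenusThreeStandard/Lines/Sketch.lean`, Aux1).

Let `T` be a Gay–Kirby trisection of a smooth `4`-manifold `M` with central surface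
`F = centralSurfaceSet T`, and `ψ : ℝ² → M` an ANNULAR CHART of `F`: on the open round annulus
`A = {r_lo < ‖x‖ < r_hi}` the map `ψ` is smooth, injective and immersive INTO `M`, with
`ψ(A) ⊆ F`.  Then for every open `V ⊆ A` the set `ψ(V)` is open in the subspace `F`: there is an
open `O ⊆ M` with `O ∩ F = ψ(V)` (`helper_exists_isOpen_inter_eq_image_of_annularChart`,
REGISTERED helper).  Road, all inputs proved in the tree:

* clause (iii) of `IsGKTrisection` for the pair `(0, 1)`: a smooth embedding `h : H → M` of a
  compact `3`-manifold with boundary with `h(∂H) = F`; the chart is transferred to the abstract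
  closed surface `∂H` (`BoundaryManifold.boundaryData 2 H`): `ψ_N = incl⁻¹ ∘ h⁻¹ ∘ ψ` is smooth
  on `A` (`Literature.Geometry.Manifold.contMDiffOn_invFun_range`), injective and immersive
  (chain rule), exactly as in `…StubBoundsDiscOfAnnularChartAux2.lean`;
* an immersion between surfaces is a local diffeomorphism
  (`Literature.Topology.FourManifolds.isImmersionAt_of_injective_mfderiv`,
  `Manifold.IsImmersionAt.isLocalDiffeomorphAt_of_finrank_eq`), hence a local homeomorphism on
  `A`, hence open on `A` (`Literature.Analysis.Calculus.isOpenMap_restrict_of_isLocalHomeomorphOn`):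
  `ψ_N(V)` is open in `∂H`;
* `j = h ∘ incl : ∂H → M` is a topological embedding with range `F`, so `ψ(V) = j(ψ_N(V))` is
  the trace on `F` of an open set of `M` (`Topology.IsInducing.image_eq_isOpen_inter_range`).

No definitions, no named facts.

References: M. W. Hirsch, *Differential Topology* (1976), Ch. 1 §3 Thms. 3.1–3.2;
J. M. Lee, *Introduction to Smooth Manifolds* (2013), Thm. 4.12, Prop. 5.22, Thm. 5.11;
R. Aranda, A. Zupan, arXiv:2503.04607 (2025), p. 2 (Thm. 1.4 "a stronger version of Thm. 1.3").
-/

-- the registered namespace `Summit.SmoothPoincare4.SmoothPoincare4.Theorems…` repeats a component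
set_option linter.dupNamespace false

noncomputable section

open scoped Manifold ContDiff Topology
open Set Function Metric Module
open Literature.Topology.FourManifolds
open Literature.Topology.FourManifolds.Trisection

namespace Summit.SmoothPoincare4.SmoothPoincare4.Theorems

/-- **Images of open plane sets under an annular chart of the central surface are open in the
central surface** (REGISTERED helper of the crux `DependentTripleGenusThreeStandard`, line
`Sketch`, exactness lemma): if `ψ : ℝ² → M` is smooth, injective and immersive into `M` on the
open annulus `A = {r_lo < ‖x‖ < r_hi}` with `ψ(A) ⊆ F = centralSurfaceSet T` for a Gay–Kirby
trisection `T`, then for every open `V ⊆ A` there is an open `O ⊆ M` with `O ∩ F = ψ(V)`.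
See the module docstring for the road (invariance of domain for equidimensional immersions).
[cite: HirschDT1976, Ch. 1 §3, Thms. 3.1–3.2]
[cite: LeeSmoothManifolds2013, Ch. 4 Thm. 4.12 and Ch. 5 Prop. 5.22] -/
theorem helper_exists_isOpen_inter_eq_image_of_annularChart :
    ∀ (M : Type) [TopologicalSpace M] [T2Space M] [SecondCountableTopology M]
      [ChartedSpace (EuclideanSpace ℝ (Fin 4)) M] [IsManifold (𝓡 4) ∞ M],
      ∀ (g : ℕ) (k : Fin 3 → ℕ) (T : Fin 3 → Set M), IsGKTrisection M g k T →
      ∀ (ψ : EuclideanSpace ℝ (Fin 2) → M) (rlo rhi : ℝ),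
      ContMDiffOn (𝓡 2) (𝓡 4) ∞ ψ {x | rlo < ‖x‖ ∧ ‖x‖ < rhi} →
      Set.InjOn ψ {x | rlo < ‖x‖ ∧ ‖x‖ < rhi} →
      (∀ x : EuclideanSpace ℝ (Fin 2), rlo < ‖x‖ → ‖x‖ < rhi →
        Function.Injective (mfderiv (𝓡 2) (𝓡 4) ψ x)) →
      ψ '' {x | rlo < ‖x‖ ∧ ‖x‖ < rhi} ⊆ centralSurfaceSet T →
      ∀ V : Set (EuclideanSpace ℝ (Fin 2)), IsOpen V → V ⊆ {x | rlo < ‖x‖ ∧ ‖x‖ < rhi} →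
      ∃ O : Set M, IsOpen O ∧ O ∩ centralSurfaceSet T = ψ '' V := by
  intro M _ _ _ _ _ g k T hT ψ rlo rhi hs hinj himm hψF V hVo hVA
  -- the empty case
  rcases V.eq_empty_or_nonempty with hV | ⟨z₀, hz₀⟩
  · subst hV
    exact ⟨∅, isOpen_empty, by simp⟩
  set A : Set (EuclideanSpace ℝ (Fin 2)) := {x | rlo < ‖x‖ ∧ ‖x‖ < rhi} with hA_def
  have hAo : IsOpen A :=
    (isOpen_lt continuous_const continuous_norm).inter (isOpen_lt continuous_norm continuous_const)
  -- clause (iii) for the pair `(0, 1)`: the handlebody `h(H)` with `h(∂H) = F`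
  have h01 : (0 : Fin 3) ≠ 1 := by decide
  obtain ⟨H, _, _, h, hM, hHc, -, -, hh, -, hbd⟩ := hT.2.2 0 1 h01
  haveI := hM
  haveI := hHc
  have hF : centralSurfaceSet T = h '' (𝓡∂ 3).boundary H := hbd.symm
  have hψA : ∀ z ∈ A, ψ z ∈ h '' (𝓡∂ 3).boundary H := fun z hz => by
    rw [← hF]; exact hψF ⟨z, hz, rfl⟩
  -- the boundary surface `∂H` as an abstract closed surface
  set bd : BoundaryData (𝓡∂ 3) H (𝓡 2) := BoundaryManifold.boundaryData 2 H with hbd_def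
  haveI : Nonempty H := by
    obtain ⟨y, -, -⟩ := hψA z₀ (hVA hz₀)
    exact ⟨y⟩
  haveI : Nonempty bd.carrier := by
    obtain ⟨y, hy, -⟩ := hψA z₀ (hVA hz₀)
    have hy' : y ∈ range bd.incl := by rw [bd.range_incl]; exact hy
    obtain ⟨n, -⟩ := hy'
    exact ⟨n⟩
  -- stage 1: the chart pulled back into `H`
  set ψH : EuclideanSpace ℝ (Fin 2) → H := fun z => invFun h (ψ z) with hψH_def
  have hinvh : ContMDiffOn (𝓡 4) (𝓡∂ 3) ∞ (invFun h) (range h) :=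
    Literature.Geometry.Manifold.contMDiffOn_invFun_range hh
  have hhψH : ∀ z ∈ A, h (ψH z) = ψ z := fun z hz => by
    obtain ⟨y, -, hy⟩ := hψA z hz
    exact invFun_eq ⟨y, hy⟩
  have hψH_bd : ∀ z ∈ A, ψH z ∈ (𝓡∂ 3).boundary H := fun z hz => by
    obtain ⟨y, hy, hyz⟩ := hψA z hz
    have : ψH z = y := hh.isEmbedding.injective (by rw [hhψH z hz, hyz])
    rw [this]; exact hy
  have hψHs : ContMDiffOn (𝓡 2) (𝓡∂ 3) ∞ ψH A :=
    hinvh.comp hs fun z hz => by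
      obtain ⟨y, -, hy⟩ := hψA z hz
      exact ⟨y, hy⟩
  -- stage 2: into the abstract surface `∂H`
  set ψN : EuclideanSpace ℝ (Fin 2) → bd.carrier := fun z => invFun bd.incl (ψH z) with hψN_def
  have hinvi : ContMDiffOn (𝓡∂ 3) (𝓡 2) ∞ (invFun bd.incl) (range bd.incl) :=
    Literature.Geometry.Manifold.contMDiffOn_invFun_range bd.isSmoothEmbedding
  have hψH_range : ∀ z ∈ A, ψH z ∈ range bd.incl := fun z hz => by
    rw [bd.range_incl]; exact hψH_bd z hz
  have hincl : ∀ z ∈ A, bd.incl (ψN z) = ψH z := fun z hz => invFun_eq (hψH_range z hz)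
  have hψNs : ContMDiffOn (𝓡 2) (𝓡 2) ∞ ψN A := hinvi.comp hψHs fun z hz => hψH_range z hz
  have hjψN : ∀ z ∈ A, h (bd.incl (ψN z)) = ψ z := fun z hz => by rw [hincl z hz, hhψH z hz]
  have himmN : ∀ z ∈ A, Injective (mfderiv (𝓡 2) (𝓡 2) ψN z) := by
    intro z hz
    have hev : ψ =ᶠ[𝓝 z] ((fun y => h (bd.incl y)) ∘ ψN) := by
      filter_upwards [hAo.mem_nhds hz] with w hw
      exact (hjψN w hw).symm
    have h1 : MDifferentiableAt (𝓡 2) (𝓡 2) ψN z :=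
      ((hψNs z hz).contMDiffAt (hAo.mem_nhds hz)).mdifferentiableAt (by simp)
    have h2 : MDifferentiableAt (𝓡 2) (𝓡∂ 3) bd.incl (ψN z) :=
      (bd.isSmoothEmbedding.contMDiff _).mdifferentiableAt (by simp)
    have h3 : MDifferentiableAt (𝓡∂ 3) (𝓡 4) h (bd.incl (ψN z)) :=
      (hh.contMDiff _).mdifferentiableAt (by simp)
    have h23 : MDifferentiableAt (𝓡 2) (𝓡 4) (fun y => h (bd.incl y)) (ψN z) := h3.comp _ h2
    have hcomp : mfderiv (𝓡 2) (𝓡 4) ψ z =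
        (mfderiv (𝓡 2) (𝓡 4) (fun y => h (bd.incl y)) (ψN z)).comp
          (mfderiv (𝓡 2) (𝓡 2) ψN z) := by
      rw [hev.mfderiv_eq]
      exact mfderiv_comp z h23 h1
    have key := himm z hz.1 hz.2
    rw [hcomp] at key
    have key' : Injective ((mfderiv (𝓡 2) (𝓡 4) (fun y => h (bd.incl y)) (ψN z)) ∘
        (mfderiv (𝓡 2) (𝓡 2) ψN z)) := key
    exact key'.of_comp
  -- an immersion between surfaces is a local diffeomorphism, hence open on `A`
  have hloc : IsLocalDiffeomorphOn (𝓡 2) (𝓡 2) ∞ ψN A := fun z =>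
    (Literature.Topology.FourManifolds.isImmersionAt_of_injective_mfderiv hAo z.2 hψNs
      (by exact_mod_cast le_top) (himmN z z.2)).isLocalDiffeomorphAt_of_finrank_eq rfl
  have hopen : IsOpenMap (A.restrict ψN) :=
    Literature.Analysis.Calculus.isOpenMap_restrict_of_isLocalHomeomorphOn
      hloc.isLocalHomeomorphOn hAo
  have hWo : IsOpen (ψN '' V) := by
    have hVeq : ψN '' V = (A.restrict ψN) '' ((Subtype.val : A → EuclideanSpace ℝ (Fin 2)) ⁻¹' V) := by
      ext y
      constructor
      · rintro ⟨z, hz, rfl⟩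
        exact ⟨⟨z, hVA hz⟩, hz, rfl⟩
      · rintro ⟨⟨z, hzA⟩, hz, rfl⟩
        exact ⟨z, hz, rfl⟩
    rw [hVeq]
    exact hopen _ (hVo.preimage continuous_subtype_val)
  -- `j = h ∘ incl` is an embedding with range `F`
  have hj : Topology.IsEmbedding (fun y => h (bd.incl y)) :=
    hh.isEmbedding.comp bd.isSmoothEmbedding.isEmbedding
  have hrangej : range (fun y => h (bd.incl y)) = centralSurfaceSet T := by
    rw [hF, show (fun y => h (bd.incl y)) = h ∘ bd.incl from rfl, range_comp, bd.range_incl]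
  obtain ⟨O, hOo, hOj⟩ := hj.isInducing.image_eq_isOpen_inter_range hWo
  refine ⟨O, hOo, ?_⟩
  rw [← hrangej, ← hOj, image_image]
  apply Subset.antisymm
  · rintro _ ⟨z, hz, rfl⟩
    exact ⟨z, hz, (hjψN z (hVA hz)).symm⟩
  · rintro _ ⟨z, hz, rfl⟩
    exact ⟨z, hz, hjψN z (hVA hz)⟩

end Summit.SmoothPoincare4.SmoothPoincare4.Theorems

end
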